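import Literature.Topology.FourManifolds.MTorusCoordinates
import HarnessLib

/-!
# The base coordinate of the tube about Gompf's disc across the seam of the mapping torus

Infrastructure for the explicit fishtail neighbourhood (R. Gompf, *More Cappell–Shaneson spheres
are standard*, Algebr. Geom. Topol. 10 (2010), proof of Thm 2.1 and Lemma 2.2; the named fact
`Literature.Topology.FourManifolds.gompf2010_framedTwist`). Over the surgered section sphere the
angular coordinate around the cap IS the base coordinate `s ∈ ℝ/ℤ` of the mapping torus, which our
real coordinate `mtPt ψ x s` (`MTorusPoints.lean`) only covers for `s ∈ (0, 3/2)` with the monodromy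
relation `[ψ x, s + 1] = [x, s]`. To write the tube over a full turn we use two real lifts:

* `Literature.Topology.FourManifolds.baseOf u = arg (-u)/(2π) + 1/2` if `re u < 0`, else
  `arg u/(2π) + 1` — a real lift of the base angle with values in `(1/4, 5/4]`;
* `Literature.Topology.FourManifolds.twoChart G (n, ϑ, a, b) = G (n, baseOf e^{iϑ}, a, b)`:
  if `G` is `1`-periodic in `s` on `(0, 1/2)` (the monodromy relation, e.g. from
  `tubeShear_midT3` and `mtPt_apply_add_one`), then near every point `twoChart G` is `G` composed
  with an affine change of the angle (`twoChart_eventuallyEq`), hence inherits smoothness and the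
  local diffeomorphism property (`isLocalDiffeomorphAt_twoChart`, and the sharper
  `isLocalDiffeomorphAt_twoChart'` needing `G` only at the base values `ϑ/(2π) + ℤ ∩ (0, 3/2)`,
  via `twoChart_eventuallyEq_int`), and it is `2π`-periodic in `ϑ`.

Everything is proved; no named facts.

## References

* R. E. Gompf, *More Cappell–Shaneson spheres are standard*, Algebr. Geom. Topol. 10 (2010)
  1665–1681, §2 (X_φ) and proof of Thm 2.1. [GompfAGT2010]
-/

noncomputable section

open scoped Real ContDiff Topology Manifold
open Set Function Filter Complex

namespace Literature.Topology.FourManifolds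

/-! ### The real lift of the base angle -/

section BaseOf

/-- **The real lift of the base angle**: `arg (-u)/(2π) + 1/2` on `re u < 0`, `arg u/(2π) + 1` else. [folklore] -/
def baseOf (u : ℂ) : ℝ := by
  classical
  exact if u.re < 0 then arg (-u) / (2 * π) + 1 / 2 else arg u / (2 * π) + 1

/-- The lift on `re u < 0`. [folklore] -/
theorem baseOf_of_neg {u : ℂ} (h : u.re < 0) : baseOf u = arg (-u) / (2 * π) + 1 / 2 := by rw [baseOf, if_pos h]

/-- The lift on `0 ≤ re u`. [folklore] -/
theorem baseOf_of_nonneg {u : ℂ} (h : 0 ≤ u.re) : baseOf u = arg u / (2 * π) + 1 := by rw [baseOf, if_neg (not_lt.2 h)]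

/-- **The lift takes values in `(1/4, 5/4]`** (in particular in `(0, 3/2)`). [folklore] -/
theorem baseOf_mem (u : ℂ) : 1 / 4 < baseOf u ∧ baseOf u ≤ 5 / 4 := by
  have hπ := Real.pi_pos
  rcases lt_or_ge u.re 0 with h | h
  · rw [baseOf_of_neg h]
    have hre : 0 ≤ (-u).re := by simp; linarith
    have h1 := (abs_arg_le_pi_div_two_iff (z := -u)).2 hre
    obtain ⟨h1a, h1b⟩ := abs_le.1 h1
    constructor
    · -- `arg (-u) > -π/2` strictly: `arg = -π/2` would force `re (-u) = 0`… we only need `> -π`? No: need `> 1/4 - …`;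
      -- `arg(-u)/(2π) + 1/2 > 1/4 ⟺ arg (-u) > -π/2`; equality `arg (-u) = -π/2` means `-u` on the negative
      -- imaginary axis, so `re u = 0`, contradicting `re u < 0`.
      have hne : arg (-u) ≠ -(π / 2) := by
        intro he
        have := (arg_eq_neg_pi_div_two_iff (z := -u)).1 he
        simp at this; linarith [this.1]
      have hlt : -(π / 2) < arg (-u) := lt_of_le_of_ne h1a (Ne.symm hne)
      have : -(1 / 4 : ℝ) < arg (-u) / (2 * π) := by
        rw [lt_div_iff₀ (by positivity)]; linarith
      linarith
    · have : arg (-u) / (2 * π) ≤ 1 / 4 := by rw [div_le_iff₀ (by positivity)]; linarith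
      linarith
  · rw [baseOf_of_nonneg h]
    have h1 := (abs_arg_le_pi_div_two_iff (z := u)).2 h
    obtain ⟨h1a, h1b⟩ := abs_le.1 h1
    constructor
    · have : -(1 / 4 : ℝ) ≤ arg u / (2 * π) := by rw [le_div_iff₀ (by positivity)]; linarith
      linarith
    · have : arg u / (2 * π) ≤ 1 / 4 := by rw [div_le_iff₀ (by positivity)]; linarith
      linarith

/-- `0 < baseOf u < 3/2`. [folklore] -/
theorem baseOf_mem' (u : ℂ) : 0 < baseOf u ∧ baseOf u < 3 / 2 := by
  have h := baseOf_mem u; constructor <;> linarith [h.1, h.2]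

/-- `arg (e^{iϑ}) = ϑ - 2πk` on the window `ϑ - 2πk ∈ (-π, π]`. [folklore] -/
theorem arg_exp_mul_I_eq {ϑ : ℝ} {k : ℤ} (h1 : -π < ϑ - 2 * π * k) (h2 : ϑ - 2 * π * k ≤ π) :
    arg (exp (ϑ * I)) = ϑ - 2 * π * k := by
  rw [Complex.arg_exp]
  simp only [mul_im, ofReal_re, I_im, mul_one, ofReal_im, I_re, mul_zero, add_zero]
  rw [toIocMod_eq_iff]
  refine ⟨⟨h1, by linarith⟩, k, ?_⟩
  simp only [zsmul_eq_mul]; ring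

/-- The lift of `e^{iϑ}` on a window with `cos ϑ > 0`: `ϑ/(2π) + 1 - k`. [folklore] -/
theorem baseOf_exp_of_cos_pos {ϑ : ℝ} {k : ℤ} (h1 : -(π / 2) ≤ ϑ - 2 * π * k) (h2 : ϑ - 2 * π * k < π / 2) :
    baseOf (exp (ϑ * I)) = ϑ / (2 * π) + 1 - k := by
  have hπ := Real.pi_pos
  have hre : 0 ≤ (exp (ϑ * I)).re := by
    rw [exp_ofReal_mul_I_re]
    have : Real.cos ϑ = Real.cos (ϑ - 2 * π * k) := by
      rw [show ϑ - 2 * π * k = ϑ - (k : ℝ) * (2 * π) by ring, Real.cos_sub_int_mul_two_pi]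
    rw [this]
    exact Real.cos_nonneg_of_mem_Icc ⟨by linarith, by linarith⟩
  rw [baseOf_of_nonneg hre, arg_exp_mul_I_eq (by linarith) (by linarith)]
  field_simp
  ring

/-- The lift of `e^{iϑ}` on a window with `cos ϑ < 0`: `ϑ/(2π) - k` (where `ϑ - π - 2πk ∈ (-π/2, π/2)`). [folklore] -/
theorem baseOf_exp_of_cos_neg {ϑ : ℝ} {k : ℤ} (h1 : -(π / 2) < ϑ - π - 2 * π * k) (h2 : ϑ - π - 2 * π * k < π / 2) :
    baseOf (exp (ϑ * I)) = ϑ / (2 * π) - k := by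
  have hπ := Real.pi_pos
  have hcos : Real.cos (ϑ - π - 2 * π * k) > 0 := Real.cos_pos_of_mem_Ioo ⟨h1, h2⟩
  have hre : (exp (ϑ * I)).re < 0 := by
    rw [exp_ofReal_mul_I_re]
    have : Real.cos ϑ = -Real.cos (ϑ - π - 2 * π * k) := by
      rw [show ϑ - π - 2 * π * k = (ϑ - π) - (k : ℝ) * (2 * π) by ring, Real.cos_sub_int_mul_two_pi,
        Real.cos_sub_pi, neg_neg]
    rw [this]; linarith
  rw [baseOf_of_neg hre]
  have hneg : -exp (ϑ * I) = exp ((ϑ - π : ℝ) * I) := by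
    rw [ofReal_sub, sub_mul, exp_sub, exp_pi_mul_I]
    ring
  rw [hneg, arg_exp_mul_I_eq (ϑ := ϑ - π) (k := k) (by linarith) (by linarith)]
  field_simp
  ring

/-- The lift is `2π`-periodic in the angle. [folklore] -/
theorem baseOf_exp_add_two_pi (ϑ : ℝ) : baseOf (exp ((ϑ + 2 * π : ℝ) * I)) = baseOf (exp (ϑ * I)) := by
  congr 1
  rw [ofReal_add, add_mul, exp_add]
  push_cast
  rw [exp_two_pi_mul_I, mul_one]

end BaseOf

/-! ### The two-chart map -/

section TwoChart

variable {M : Type*} (G : ℝ × ℝ × ℝ × ℝ → M)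

/-- **The tube over a full turn of the base**: `(n, ϑ, a, b) ↦ G (n, baseOf e^{iϑ}, a, b)`. [folklore] -/
def twoChart (q : ℝ × ℝ × ℝ × ℝ) : M := G (q.1, baseOf (exp (q.2.1 * I)), q.2.2)

variable {G}

/-- The two-chart map is `2π`-periodic in the angle. [folklore] -/
theorem twoChart_add_two_pi (q : ℝ × ℝ × ℝ × ℝ) : twoChart G (q.1, q.2.1 + 2 * π, q.2.2) = twoChart G q := by
  show G (q.1, baseOf (exp ((q.2.1 + 2 * π : ℝ) * I)), q.2.2) = G (q.1, baseOf (exp (q.2.1 * I)), q.2.2)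
  rw [baseOf_exp_add_two_pi]

/-- The affine change of the angle `(n, ϑ, a, b) ↦ (n, ϑ/(2π) + c, a, b)`, a diffeomorphism. [folklore] -/
def angleAffine (c : ℝ) : (ℝ × ℝ × ℝ × ℝ) ≃ₘ⟮𝓘(ℝ, ℝ × ℝ × ℝ × ℝ), 𝓘(ℝ, ℝ × ℝ × ℝ × ℝ)⟯ (ℝ × ℝ × ℝ × ℝ) where
  toFun q := (q.1, q.2.1 / (2 * π) + c, q.2.2)
  invFun p := (p.1, (p.2.1 - c) * (2 * π), p.2.2)
  left_inv q := by
    obtain ⟨n, ϑ, w⟩ := q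
    simp only [Prod.mk.injEq, true_and, and_true]
    field_simp
    ring
  right_inv p := by
    obtain ⟨n, s, w⟩ := p
    simp only [Prod.mk.injEq, true_and, and_true]
    field_simp
    ring
  contMDiff_toFun := contMDiff_iff_contDiff.2 <|
    contDiff_fst.prodMk ((((contDiff_fst.comp contDiff_snd).div_const _).add contDiff_const).prodMk
      (contDiff_snd.comp contDiff_snd))
  contMDiff_invFun := contMDiff_iff_contDiff.2 <|
    contDiff_fst.prodMk ((((contDiff_fst.comp contDiff_snd).sub contDiff_const).mul contDiff_const).prodMk
      (contDiff_snd.comp contDiff_snd))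

/-- The value of `angleAffine`. [folklore] -/
@[simp] theorem angleAffine_apply (c : ℝ) (q : ℝ × ℝ × ℝ × ℝ) : angleAffine c q = (q.1, q.2.1 / (2 * π) + c, q.2.2) := rfl

/-- Reduction of a real angle modulo `2π` into `(-π, π]`. [folklore] -/
theorem exists_angle_decomp (ϑ : ℝ) : ∃ (k : ℤ) (ϑ₀ : ℝ), -π < ϑ₀ ∧ ϑ₀ ≤ π ∧ ϑ = ϑ₀ + 2 * π * k := by
  refine ⟨toIocDiv Real.two_pi_pos (-π) ϑ, toIocMod Real.two_pi_pos (-π) ϑ, (toIocMod_mem_Ioc _ _ _).1,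
    by linarith [(toIocMod_mem_Ioc Real.two_pi_pos (-π) ϑ).2], ?_⟩
  have h := toIocMod_add_toIocDiv_zsmul Real.two_pi_pos (-π) ϑ
  rw [zsmul_eq_mul] at h
  linarith

/-- `cos ϑ₀ = 0` with `ϑ₀ ∈ (-π, π]` forces `ϑ₀ = ±π/2`. [folklore] -/
theorem eq_or_eq_of_cos_eq_zero {ϑ₀ : ℝ} (h1 : -π < ϑ₀) (h2 : ϑ₀ ≤ π) (h : Real.cos ϑ₀ = 0) :
    ϑ₀ = π / 2 ∨ ϑ₀ = -(π / 2) := by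
  obtain ⟨m, hm⟩ := Real.cos_eq_zero_iff.1 h
  have hπ := Real.pi_pos
  have hm1 : (m : ℝ) < 1 := by
    by_contra hc
    rw [not_lt] at hc
    nlinarith
  have hm2 : (-2 : ℝ) < m := by
    by_contra hc
    rw [not_lt] at hc
    nlinarith
  have hm1' : m < 1 := by exact_mod_cast hm1
  have hm2' : -2 < m := by exact_mod_cast hm2
  have hm' : m = 0 ∨ m = -1 := by omega
  rcases hm' with rfl | rfl
  · left; push_cast at hm; linarith
  · right; push_cast at hm; linarith

/-- **Near every point the two-chart map is `G` after an INTEGER affine change of the angle**,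
provided `G` is `1`-periodic in `s` on `(0, 1/2)`; the base value at the point lies in `(0, 3/2)`
and is congruent to `ϑ/(2π)` modulo `1`. [folklore] -/
theorem twoChart_eventuallyEq_int (hper : ∀ n s (w : ℝ × ℝ), 0 < s → s < 1 / 2 → G (n, s + 1, w) = G (n, s, w))
    (q : ℝ × ℝ × ℝ × ℝ) :
    ∃ c : ℤ, 0 < q.2.1 / (2 * π) + c ∧ q.2.1 / (2 * π) + c < 3 / 2 ∧
      twoChart G =ᶠ[𝓝 q] fun q' ↦ G (angleAffine c q') := by
  have hπ := Real.pi_pos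
  have h2π : (0 : ℝ) < 2 * π := by positivity
  obtain ⟨k, ϑ₀, hlo, hhi, hdec⟩ := exists_angle_decomp q.2.1
  -- open windows in `ϑ` are open sets of `ℝ⁴`
  have hopen : ∀ lo hi : ℝ, IsOpen {q' : ℝ × ℝ × ℝ × ℝ | lo < q'.2.1 ∧ q'.2.1 < hi} := fun lo hi ↦
    (isOpen_lt continuous_const (continuous_fst.comp continuous_snd)).inter
      (isOpen_lt (continuous_fst.comp continuous_snd) continuous_const)
  -- useful conversions between `ϑ'/(2π)` bounds and `ϑ'` bounds
  have divlt : ∀ {x y : ℝ}, x < 2 * π * y → x / (2 * π) < y := fun {x y} h ↦ by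
    rw [div_lt_iff₀ h2π]; linarith
  have ltdiv : ∀ {x y : ℝ}, 2 * π * y < x → y < x / (2 * π) := fun {x y} h ↦ by
    rw [lt_div_iff₀ h2π]; linarith
  -- the three generic windows: (P) `cos > 0`-type window around `2πk'`, (N) `cos < 0`-type around `2πk' + π`
  have winP : ∀ (k' : ℤ) (q' : ℝ × ℝ × ℝ × ℝ), 2 * π * k' - π / 2 ≤ q'.2.1 → q'.2.1 < 2 * π * k' + π / 2 →
      twoChart G q' = G (angleAffine (1 - k') q') := by
    intro k' q' ha hb
    simp only [twoChart, angleAffine_apply]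
    rw [baseOf_exp_of_cos_pos (k := k') (by linarith) (by linarith)]
    refine congrArg G (Prod.ext rfl (Prod.ext ?_ rfl))
    simp only
    ring
  have winN : ∀ (k' : ℤ) (q' : ℝ × ℝ × ℝ × ℝ), 2 * π * k' + π / 2 < q'.2.1 → q'.2.1 < 2 * π * k' + 3 * π / 2 →
      twoChart G q' = G (angleAffine (-k') q') := by
    intro k' q' ha hb
    simp only [twoChart, angleAffine_apply]
    rw [baseOf_exp_of_cos_neg (k := k') (by linarith) (by linarith)]
    refine congrArg G (Prod.ext rfl (Prod.ext ?_ rfl))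
    simp only
    ring
  -- at the top point `ϑ' = 2πk' + π/2` exactly, and just below it, the `cos ≥ 0` branch reads
  -- `G (n, ϑ'/(2π) + 1 - k', w)`, which periodicity turns into `G (n, ϑ'/(2π) - k', w)`
  have winT : ∀ (k' : ℤ) (q' : ℝ × ℝ × ℝ × ℝ), 2 * π * k' < q'.2.1 → q'.2.1 ≤ 2 * π * k' + π / 2 →
      twoChart G q' = G (angleAffine (-k') q') := by
    intro k' q' ha hb
    simp only [twoChart, angleAffine_apply]
    have hre : 0 ≤ (exp (q'.2.1 * I)).re := by
      rw [exp_ofReal_mul_I_re]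
      have : Real.cos q'.2.1 = Real.cos (q'.2.1 - 2 * π * k') := by
        rw [show q'.2.1 - 2 * π * k' = q'.2.1 - (k' : ℝ) * (2 * π) by ring, Real.cos_sub_int_mul_two_pi]
      rw [this]
      exact Real.cos_nonneg_of_mem_Icc ⟨by linarith, by linarith⟩
    rw [baseOf_of_nonneg hre, arg_exp_mul_I_eq (k := k') (by linarith) (by linarith)]
    have hs0 : 0 < q'.2.1 / (2 * π) - k' := by have := ltdiv (x := q'.2.1) (y := (k' : ℝ)) (by linarith); linarith
    have hs1 : q'.2.1 / (2 * π) - k' < 1 / 2 := by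
      have := divlt (x := q'.2.1) (y := (k' : ℝ) + 1 / 2) (by linarith); linarith
    rw [show (q'.2.1 - 2 * π * k') / (2 * π) + 1 = (q'.2.1 / (2 * π) - k') + 1 by field_simp,
      hper _ _ _ hs0 hs1]
    refine congrArg G (Prod.ext rfl (Prod.ext ?_ rfl))
    simp only
    ring
  -- case analysis on `ϑ₀`
  rcases lt_trichotomy (Real.cos ϑ₀) 0 with hneg | hzero | hpos
  · -- `cos ϑ₀ < 0`
    rcases lt_or_ge 0 ϑ₀ with hϑpos | hϑnonpos
    · -- `ϑ₀ ∈ (π/2, π]`: window N with `k`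
      have h1 : π / 2 < ϑ₀ := by
        by_contra h
        rw [not_lt] at h
        have := Real.cos_nonneg_of_mem_Icc ⟨by linarith, h⟩; linarith
      refine ⟨-k, ?_, ?_, ?_⟩
      · push_cast; have := ltdiv (x := q.2.1) (y := (k : ℝ)) (by linarith); linarith
      · push_cast; have := divlt (x := q.2.1) (y := (k : ℝ) + 3 / 4) (by linarith); linarith
      · have hmem : 2 * π * k + π / 2 < q.2.1 ∧ q.2.1 < 2 * π * k + 3 * π / 2 := ⟨by linarith, by linarith⟩
        filter_upwards [(hopen _ _).mem_nhds hmem] with q' hq'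
        rw [winN k q' hq'.1 hq'.2]; push_cast; rfl
    · -- `ϑ₀ ∈ (-π, -π/2)`: window N with `k - 1`
      have h1 : ϑ₀ < -(π / 2) := by
        by_contra h
        rw [not_lt] at h
        have := Real.cos_nonneg_of_mem_Icc ⟨h, by linarith⟩; linarith
      refine ⟨-(k - 1), ?_, ?_, ?_⟩
      · push_cast; have := ltdiv (x := q.2.1) (y := (k : ℝ) - 1 / 2) (by linarith); linarith
      · push_cast; have := divlt (x := q.2.1) (y := (k : ℝ)) (by linarith); linarith
      · have hmem : 2 * π * (k - 1 : ℤ) + π / 2 < q.2.1 ∧ q.2.1 < 2 * π * (k - 1 : ℤ) + 3 * π / 2 := by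
          push_cast; constructor <;> linarith
        filter_upwards [(hopen _ _).mem_nhds hmem] with q' hq'
        rw [winN (k - 1) q' hq'.1 hq'.2]; push_cast; rfl
  · -- `cos ϑ₀ = 0`
    rcases eq_or_eq_of_cos_eq_zero hlo hhi hzero with htop | hbot
    · -- `ϑ₀ = π/2`: window `(2πk, 2πk + π)`: below/at the top use `winT`, above use `winN`
      refine ⟨-k, ?_, ?_, ?_⟩
      · push_cast; have := ltdiv (x := q.2.1) (y := (k : ℝ)) (by linarith); linarith
      · push_cast; have := divlt (x := q.2.1) (y := (k : ℝ) + 1) (by linarith); linarith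
      · have hmem : 2 * π * k < q.2.1 ∧ q.2.1 < 2 * π * k + π := ⟨by linarith, by linarith⟩
        filter_upwards [(hopen _ _).mem_nhds hmem] with q' hq'
        rcases le_or_gt q'.2.1 (2 * π * k + π / 2) with hle | hgt
        · rw [winT k q' hq'.1 hle]; push_cast; rfl
        · rw [winN k q' hgt (by linarith [hq'.2])]; push_cast; rfl
    · -- `ϑ₀ = -π/2`: window `(2πk - π, 2πk)`: below use `winN (k-1)`, at/above use `winT (k-1)`… both give
      -- the constant `-(k-1) = 1 - k`; and `winP k` on `(2πk - π/2, 2πk)` also gives `1 - k`.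
      refine ⟨1 - k, ?_, ?_, ?_⟩
      · push_cast; have := ltdiv (x := q.2.1) (y := (k : ℝ) - 1 / 2) (by linarith); linarith
      · push_cast; have := divlt (x := q.2.1) (y := (k : ℝ)) (by linarith); linarith
      · have hmem : 2 * π * k - π < q.2.1 ∧ q.2.1 < 2 * π * k := ⟨by linarith, by linarith⟩
        filter_upwards [(hopen _ _).mem_nhds hmem] with q' hq'
        rcases lt_or_ge q'.2.1 (2 * π * k - π / 2) with hlt | hge
        · rw [winN (k - 1) q' (by push_cast; linarith [hq'.1]) (by push_cast; linarith)]
          push_cast; ring_nf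
        · rw [winP k q' hge (by linarith [hq'.2])]; push_cast; rfl
  · -- `cos ϑ₀ > 0`: `ϑ₀ ∈ (-π/2, π/2)`, window P with `k`
    have h1 : -(π / 2) < ϑ₀ := by
      by_contra h
      rw [not_lt] at h
      have := Real.cos_nonpos_of_pi_div_two_le_of_le (x := -ϑ₀) (by linarith) (by linarith)
      rw [Real.cos_neg] at this; linarith
    have h2 : ϑ₀ < π / 2 := by
      by_contra h
      rw [not_lt] at h
      have := Real.cos_nonpos_of_pi_div_two_le_of_le h (by linarith); linarith
    refine ⟨1 - k, ?_, ?_, ?_⟩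
    · push_cast; have := ltdiv (x := q.2.1) (y := (k : ℝ) - 1 / 4) (by linarith); linarith
    · push_cast; have := divlt (x := q.2.1) (y := (k : ℝ) + 1 / 4) (by linarith); linarith
    · have hmem : 2 * π * k - π / 2 < q.2.1 ∧ q.2.1 < 2 * π * k + π / 2 := ⟨by linarith, by linarith⟩
      filter_upwards [(hopen _ _).mem_nhds hmem] with q' hq'
      rw [winP k q' hq'.1.le hq'.2]; push_cast; rfl

/-- **Near every point the two-chart map is `G` after an affine change of the angle**, provided
`G` is `1`-periodic in `s` on `(0, 1/2)` (the monodromy relation). The base value at the point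
lies in `(0, 3/2)`. [folklore] -/
theorem twoChart_eventuallyEq (hper : ∀ n s (w : ℝ × ℝ), 0 < s → s < 1 / 2 → G (n, s + 1, w) = G (n, s, w))
    (q : ℝ × ℝ × ℝ × ℝ) :
    ∃ c : ℝ, 0 < q.2.1 / (2 * π) + c ∧ q.2.1 / (2 * π) + c < 3 / 2 ∧
      twoChart G =ᶠ[𝓝 q] fun q' ↦ G (angleAffine c q') := by
  obtain ⟨c, h0, h1, h⟩ := twoChart_eventuallyEq_int hper q
  exact ⟨c, h0, h1, h⟩

variable {E H : Type*} [NormedAddCommGroup E] [NormedSpace ℝ E] [TopologicalSpace H] {J : ModelWithCorners ℝ E H}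
  [TopologicalSpace M] [ChartedSpace H M]

/-- **The two-chart map is a local diffeomorphism** at every point, provided `G` is `1`-periodic
in `s` on `(0, 1/2)` and a local diffeomorphism at the points `(n, s, w)` with `0 < s < 3/2`. [folklore] -/
theorem isLocalDiffeomorphAt_twoChart (hper : ∀ n s (w : ℝ × ℝ), 0 < s → s < 1 / 2 → G (n, s + 1, w) = G (n, s, w))
    {q : ℝ × ℝ × ℝ × ℝ} (hG : ∀ s : ℝ, 0 < s → s < 3 / 2 → IsLocalDiffeomorphAt 𝓘(ℝ, ℝ × ℝ × ℝ × ℝ) J ∞ G (q.1, s, q.2.2)) :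
    IsLocalDiffeomorphAt 𝓘(ℝ, ℝ × ℝ × ℝ × ℝ) J ∞ (twoChart G) q := by
  obtain ⟨c, h0, h1, heq⟩ := twoChart_eventuallyEq hper q
  have hA : IsLocalDiffeomorphAt 𝓘(ℝ, ℝ × ℝ × ℝ × ℝ) 𝓘(ℝ, ℝ × ℝ × ℝ × ℝ) ∞ (angleAffine c) q :=
    (angleAffine c).isLocalDiffeomorph q
  have h := hA.comp (K := J) (P := M) (hG _ h0 h1)
  exact isLocalDiffeomorphAt_congr_nhds' h heq

/-- **Smoothness of the two-chart map** at every point, from smoothness of `G` at base values in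
`(0, 3/2)` and the periodicity. [folklore] -/
theorem contMDiffAt_twoChart (hper : ∀ n s (w : ℝ × ℝ), 0 < s → s < 1 / 2 → G (n, s + 1, w) = G (n, s, w))
    {q : ℝ × ℝ × ℝ × ℝ} (hG : ∀ s : ℝ, 0 < s → s < 3 / 2 → ContMDiffAt 𝓘(ℝ, ℝ × ℝ × ℝ × ℝ) J ∞ G (q.1, s, q.2.2)) :
    ContMDiffAt 𝓘(ℝ, ℝ × ℝ × ℝ × ℝ) J ∞ (twoChart G) q := by
  obtain ⟨c, h0, h1, heq⟩ := twoChart_eventuallyEq hper q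
  have hA : ContMDiffAt 𝓘(ℝ, ℝ × ℝ × ℝ × ℝ) 𝓘(ℝ, ℝ × ℝ × ℝ × ℝ) ∞ (angleAffine c) q := (angleAffine c).contMDiff.contMDiffAt
  exact ((hG _ h0 h1).comp q hA).congr_of_eventuallyEq heq

/-- **The two-chart map is a local diffeomorphism** at a point, provided `G` is `1`-periodic in `s`
on `(0, 1/2)` and a local diffeomorphism at the (at most two) base values `s = ϑ/(2π) + c ∈ (0, 3/2)`,
`c ∈ ℤ`. [folklore] -/
theorem isLocalDiffeomorphAt_twoChart' (hper : ∀ n s (w : ℝ × ℝ), 0 < s → s < 1 / 2 → G (n, s + 1, w) = G (n, s, w))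
    {q : ℝ × ℝ × ℝ × ℝ} (hG : ∀ c : ℤ, 0 < q.2.1 / (2 * π) + c → q.2.1 / (2 * π) + c < 3 / 2 →
      IsLocalDiffeomorphAt 𝓘(ℝ, ℝ × ℝ × ℝ × ℝ) J ∞ G (q.1, q.2.1 / (2 * π) + c, q.2.2)) :
    IsLocalDiffeomorphAt 𝓘(ℝ, ℝ × ℝ × ℝ × ℝ) J ∞ (twoChart G) q := by
  obtain ⟨c, h0, h1, heq⟩ := twoChart_eventuallyEq_int hper q
  have hA : IsLocalDiffeomorphAt 𝓘(ℝ, ℝ × ℝ × ℝ × ℝ) 𝓘(ℝ, ℝ × ℝ × ℝ × ℝ) ∞ (angleAffine c) q :=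
    (angleAffine c).isLocalDiffeomorph q
  have h := hA.comp (K := J) (P := M) (hG c h0 h1)
  exact isLocalDiffeomorphAt_congr_nhds' h heq

/-- **Smoothness of the two-chart map** at a point, from smoothness of `G` at the base values
`s = ϑ/(2π) + c ∈ (0, 3/2)`, `c ∈ ℤ`, and the periodicity. [folklore] -/
theorem contMDiffAt_twoChart' (hper : ∀ n s (w : ℝ × ℝ), 0 < s → s < 1 / 2 → G (n, s + 1, w) = G (n, s, w))
    {q : ℝ × ℝ × ℝ × ℝ} (hG : ∀ c : ℤ, 0 < q.2.1 / (2 * π) + c → q.2.1 / (2 * π) + c < 3 / 2 →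
      ContMDiffAt 𝓘(ℝ, ℝ × ℝ × ℝ × ℝ) J ∞ G (q.1, q.2.1 / (2 * π) + c, q.2.2)) :
    ContMDiffAt 𝓘(ℝ, ℝ × ℝ × ℝ × ℝ) J ∞ (twoChart G) q := by
  obtain ⟨c, h0, h1, heq⟩ := twoChart_eventuallyEq_int hper q
  have hA : ContMDiffAt 𝓘(ℝ, ℝ × ℝ × ℝ × ℝ) 𝓘(ℝ, ℝ × ℝ × ℝ × ℝ) ∞ (angleAffine c) q := (angleAffine c).contMDiff.contMDiffAt
  exact ((hG c h0 h1).comp q hA).congr_of_eventuallyEq heq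

/-! #### Localised periodicity

The periodicity hypothesis is only needed near the point: for latitude–base maps whose
periodicity holds on the region of interest but not for junk parameter values. -/

omit [TopologicalSpace M] in
/-- **Near every point the two-chart map is `G` after an integer affine change of the angle**,
assuming the periodicity only for `(n, w)` near `(q.1, q.2.2)`. [folklore] -/
theorem twoChart_eventuallyEq_loc {q : ℝ × ℝ × ℝ × ℝ}
    (hper : ∀ᶠ p in 𝓝 (q.1, q.2.2), ∀ s : ℝ, 0 < s → s < 1 / 2 → G (p.1, s + 1, p.2) = G (p.1, s, p.2)) :
    ∃ c : ℤ, 0 < q.2.1 / (2 * π) + c ∧ q.2.1 / (2 * π) + c < 3 / 2 ∧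
      twoChart G =ᶠ[𝓝 q] fun q' ↦ G (angleAffine c q') := by
  have hπ := Real.pi_pos
  have h2π : (0 : ℝ) < 2 * π := by positivity
  obtain ⟨k, ϑ₀, hlo, hhi, hdec⟩ := exists_angle_decomp q.2.1
  -- the periodicity neighbourhood, pulled back to `ℝ⁴`
  have hperq : ∀ᶠ q' in 𝓝 q, ∀ s : ℝ, 0 < s → s < 1 / 2 → G (q'.1, s + 1, q'.2.2) = G (q'.1, s, q'.2.2) := by
    have hc : Continuous fun q' : ℝ × ℝ × ℝ × ℝ ↦ (q'.1, q'.2.2) := continuous_fst.prodMk (continuous_snd.comp continuous_snd)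
    exact hc.continuousAt.eventually hper
  have hopen : ∀ lo hi : ℝ, IsOpen {q' : ℝ × ℝ × ℝ × ℝ | lo < q'.2.1 ∧ q'.2.1 < hi} := fun lo hi ↦
    (isOpen_lt continuous_const (continuous_fst.comp continuous_snd)).inter
      (isOpen_lt (continuous_fst.comp continuous_snd) continuous_const)
  have divlt : ∀ {x y : ℝ}, x < 2 * π * y → x / (2 * π) < y := fun {x y} h ↦ by
    rw [div_lt_iff₀ h2π]; linarith
  have ltdiv : ∀ {x y : ℝ}, 2 * π * y < x → y < x / (2 * π) := fun {x y} h ↦ by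
    rw [lt_div_iff₀ h2π]; linarith
  have winP : ∀ (k' : ℤ) (q' : ℝ × ℝ × ℝ × ℝ), 2 * π * k' - π / 2 ≤ q'.2.1 → q'.2.1 < 2 * π * k' + π / 2 →
      twoChart G q' = G (angleAffine (1 - k') q') := by
    intro k' q' ha hb
    simp only [twoChart, angleAffine_apply]
    rw [baseOf_exp_of_cos_pos (k := k') (by linarith) (by linarith)]
    refine congrArg G (Prod.ext rfl (Prod.ext ?_ rfl))
    simp only
    ring
  have winN : ∀ (k' : ℤ) (q' : ℝ × ℝ × ℝ × ℝ), 2 * π * k' + π / 2 < q'.2.1 → q'.2.1 < 2 * π * k' + 3 * π / 2 →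
      twoChart G q' = G (angleAffine (-k') q') := by
    intro k' q' ha hb
    simp only [twoChart, angleAffine_apply]
    rw [baseOf_exp_of_cos_neg (k := k') (by linarith) (by linarith)]
    refine congrArg G (Prod.ext rfl (Prod.ext ?_ rfl))
    simp only
    ring
  have winT : ∀ (k' : ℤ) (q' : ℝ × ℝ × ℝ × ℝ), (∀ s : ℝ, 0 < s → s < 1 / 2 → G (q'.1, s + 1, q'.2.2) = G (q'.1, s, q'.2.2)) →
      2 * π * k' < q'.2.1 → q'.2.1 ≤ 2 * π * k' + π / 2 → twoChart G q' = G (angleAffine (-k') q') := by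
    intro k' q' hper' ha hb
    simp only [twoChart, angleAffine_apply]
    have hre : 0 ≤ (exp (q'.2.1 * I)).re := by
      rw [exp_ofReal_mul_I_re]
      have : Real.cos q'.2.1 = Real.cos (q'.2.1 - 2 * π * k') := by
        rw [show q'.2.1 - 2 * π * k' = q'.2.1 - (k' : ℝ) * (2 * π) by ring, Real.cos_sub_int_mul_two_pi]
      rw [this]
      exact Real.cos_nonneg_of_mem_Icc ⟨by linarith, by linarith⟩
    rw [baseOf_of_nonneg hre, arg_exp_mul_I_eq (k := k') (by linarith) (by linarith)]
    have hs0 : 0 < q'.2.1 / (2 * π) - k' := by have := ltdiv (x := q'.2.1) (y := (k' : ℝ)) (by linarith); linarith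
    have hs1 : q'.2.1 / (2 * π) - k' < 1 / 2 := by
      have := divlt (x := q'.2.1) (y := (k' : ℝ) + 1 / 2) (by linarith); linarith
    rw [show (q'.2.1 - 2 * π * k') / (2 * π) + 1 = (q'.2.1 / (2 * π) - k') + 1 by field_simp,
      hper' _ hs0 hs1]
    refine congrArg G (Prod.ext rfl (Prod.ext ?_ rfl))
    simp only
    ring
  rcases lt_trichotomy (Real.cos ϑ₀) 0 with hneg | hzero | hpos
  · rcases lt_or_ge 0 ϑ₀ with hϑpos | hϑnonpos
    · have h1 : π / 2 < ϑ₀ := by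
        by_contra h
        rw [not_lt] at h
        have := Real.cos_nonneg_of_mem_Icc ⟨by linarith, h⟩; linarith
      refine ⟨-k, ?_, ?_, ?_⟩
      · push_cast; have := ltdiv (x := q.2.1) (y := (k : ℝ)) (by linarith); linarith
      · push_cast; have := divlt (x := q.2.1) (y := (k : ℝ) + 3 / 4) (by linarith); linarith
      · have hmem : 2 * π * k + π / 2 < q.2.1 ∧ q.2.1 < 2 * π * k + 3 * π / 2 := ⟨by linarith, by linarith⟩
        filter_upwards [(hopen _ _).mem_nhds hmem] with q' hq'
        rw [winN k q' hq'.1 hq'.2]; push_cast; rfl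
    · have h1 : ϑ₀ < -(π / 2) := by
        by_contra h
        rw [not_lt] at h
        have := Real.cos_nonneg_of_mem_Icc ⟨h, by linarith⟩; linarith
      refine ⟨-(k - 1), ?_, ?_, ?_⟩
      · push_cast; have := ltdiv (x := q.2.1) (y := (k : ℝ) - 1 / 2) (by linarith); linarith
      · push_cast; have := divlt (x := q.2.1) (y := (k : ℝ)) (by linarith); linarith
      · have hmem : 2 * π * (k - 1 : ℤ) + π / 2 < q.2.1 ∧ q.2.1 < 2 * π * (k - 1 : ℤ) + 3 * π / 2 := by
          push_cast; constructor <;> linarith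
        filter_upwards [(hopen _ _).mem_nhds hmem] with q' hq'
        rw [winN (k - 1) q' hq'.1 hq'.2]; push_cast; rfl
  · rcases eq_or_eq_of_cos_eq_zero hlo hhi hzero with htop | hbot
    · refine ⟨-k, ?_, ?_, ?_⟩
      · push_cast; have := ltdiv (x := q.2.1) (y := (k : ℝ)) (by linarith); linarith
      · push_cast; have := divlt (x := q.2.1) (y := (k : ℝ) + 1) (by linarith); linarith
      · have hmem : 2 * π * k < q.2.1 ∧ q.2.1 < 2 * π * k + π := ⟨by linarith, by linarith⟩
        filter_upwards [(hopen _ _).mem_nhds hmem, hperq] with q' hq' hper'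
        rcases le_or_gt q'.2.1 (2 * π * k + π / 2) with hle | hgt
        · rw [winT k q' hper' hq'.1 hle]; push_cast; rfl
        · rw [winN k q' hgt (by linarith [hq'.2])]; push_cast; rfl
    · refine ⟨1 - k, ?_, ?_, ?_⟩
      · push_cast; have := ltdiv (x := q.2.1) (y := (k : ℝ) - 1 / 2) (by linarith); linarith
      · push_cast; have := divlt (x := q.2.1) (y := (k : ℝ)) (by linarith); linarith
      · have hmem : 2 * π * k - π < q.2.1 ∧ q.2.1 < 2 * π * k := ⟨by linarith, by linarith⟩
        filter_upwards [(hopen _ _).mem_nhds hmem] with q' hq'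
        rcases lt_or_ge q'.2.1 (2 * π * k - π / 2) with hlt | hge
        · rw [winN (k - 1) q' (by push_cast; linarith [hq'.1]) (by push_cast; linarith)]
          push_cast; ring_nf
        · rw [winP k q' hge (by linarith [hq'.2])]; push_cast; rfl
  · have h1 : -(π / 2) < ϑ₀ := by
      by_contra h
      rw [not_lt] at h
      have := Real.cos_nonpos_of_pi_div_two_le_of_le (x := -ϑ₀) (by linarith) (by linarith)
      rw [Real.cos_neg] at this; linarith
    have h2 : ϑ₀ < π / 2 := by
      by_contra h
      rw [not_lt] at h
      have := Real.cos_nonpos_of_pi_div_two_le_of_le h (by linarith); linarith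
    refine ⟨1 - k, ?_, ?_, ?_⟩
    · push_cast; have := ltdiv (x := q.2.1) (y := (k : ℝ) - 1 / 4) (by linarith); linarith
    · push_cast; have := divlt (x := q.2.1) (y := (k : ℝ) + 1 / 4) (by linarith); linarith
    · have hmem : 2 * π * k - π / 2 < q.2.1 ∧ q.2.1 < 2 * π * k + π / 2 := ⟨by linarith, by linarith⟩
      filter_upwards [(hopen _ _).mem_nhds hmem] with q' hq'
      rw [winP k q' hq'.1.le hq'.2]; push_cast; rfl

/-- **The two-chart map is a local diffeomorphism** at a point, with the periodicity assumed only
for `(n, w)` near `(q.1, q.2.2)`, and `G` a local diffeomorphism at the base values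
`ϑ/(2π) + ℤ ∩ (0, 3/2)`. [folklore] -/
theorem isLocalDiffeomorphAt_twoChart_loc {q : ℝ × ℝ × ℝ × ℝ}
    (hper : ∀ᶠ p in 𝓝 (q.1, q.2.2), ∀ s : ℝ, 0 < s → s < 1 / 2 → G (p.1, s + 1, p.2) = G (p.1, s, p.2))
    (hG : ∀ c : ℤ, 0 < q.2.1 / (2 * π) + c → q.2.1 / (2 * π) + c < 3 / 2 →
      IsLocalDiffeomorphAt 𝓘(ℝ, ℝ × ℝ × ℝ × ℝ) J ∞ G (q.1, q.2.1 / (2 * π) + c, q.2.2)) :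
    IsLocalDiffeomorphAt 𝓘(ℝ, ℝ × ℝ × ℝ × ℝ) J ∞ (twoChart G) q := by
  obtain ⟨c, h0, h1, heq⟩ := twoChart_eventuallyEq_loc hper
  have hA : IsLocalDiffeomorphAt 𝓘(ℝ, ℝ × ℝ × ℝ × ℝ) 𝓘(ℝ, ℝ × ℝ × ℝ × ℝ) ∞ (angleAffine c) q :=
    (angleAffine c).isLocalDiffeomorph q
  have h := hA.comp (K := J) (P := M) (hG c h0 h1)
  exact isLocalDiffeomorphAt_congr_nhds' h heq

/-- **Smoothness of the two-chart map** at a point under the localised periodicity. [folklore] -/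
theorem contMDiffAt_twoChart_loc {q : ℝ × ℝ × ℝ × ℝ}
    (hper : ∀ᶠ p in 𝓝 (q.1, q.2.2), ∀ s : ℝ, 0 < s → s < 1 / 2 → G (p.1, s + 1, p.2) = G (p.1, s, p.2))
    (hG : ∀ c : ℤ, 0 < q.2.1 / (2 * π) + c → q.2.1 / (2 * π) + c < 3 / 2 →
      ContMDiffAt 𝓘(ℝ, ℝ × ℝ × ℝ × ℝ) J ∞ G (q.1, q.2.1 / (2 * π) + c, q.2.2)) :
    ContMDiffAt 𝓘(ℝ, ℝ × ℝ × ℝ × ℝ) J ∞ (twoChart G) q := by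
  obtain ⟨c, h0, h1, heq⟩ := twoChart_eventuallyEq_loc hper
  have hA : ContMDiffAt 𝓘(ℝ, ℝ × ℝ × ℝ × ℝ) 𝓘(ℝ, ℝ × ℝ × ℝ × ℝ) ∞ (angleAffine c) q := (angleAffine c).contMDiff.contMDiffAt
  exact ((hG c h0 h1).comp q hA).congr_of_eventuallyEq heq

omit [TopologicalSpace M] in
/-- The value of the two-chart map: `G` at the base value `baseOf e^{iϑ} ∈ (1/4, 5/4]`. [folklore] -/
theorem twoChart_apply (q : ℝ × ℝ × ℝ × ℝ) : twoChart G q = G (q.1, baseOf (exp (q.2.1 * I)), q.2.2) := rfl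

end TwoChart

end Literature.Topology.FourManifolds
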